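import Summits.CriticalPhenomena.PercolationContinuityZ3.Theorems.PercNearOneGluingNoHeavyLowerTailSahiOneStepFibreF3MonoReduce
import HarnessLib

/-!
# One-step scheme: one-token monotonicity of the fibre form from SECOND-ORDER monotonicity ("the drop is smallest at inactive neighbours")

Support file (prover prim-ineq-prove-3 gen 23; `--supports stmt-CriticalPhenomena-4575`; memo
`run/shared/lean/prim/prim-ineq-prove-3/FINDING-G23-SUPERADDITIVITY.md` §7).  No definitions, no named facts, no sorries, no `native_decide`.

`…FibreF3MonoReduce` reduced Kahn C5 for every threshold slot to the one-token monotonicity `M_hi`: the *drop*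
  `drop_e(D₁,D₂,θ,U,V) := f3sum ℝ D₁ D₂ θ 1_U 1_V − f3sum ℝ (D₁.erase e) (D₂.erase e) (θ−1) 1_{U_e} 1_{V_e}`
is nonnegative for every active coordinate `e`.  This file reduces `M_hi` further to the two SECOND-ORDER statements of the memo (T11/T21 and T12/T22):
for a second active coordinate `e' ≠ e` the drop does not increase when `e'` is made inactive by one bit flip —
* `e' ∈ D₁` (held by one copy) is *deleted* (`D₁.erase e'`, same threshold, same families), or
* `e' ∈ D₂` (held by two copies) is *raised* (`D₂.erase e'`, threshold `θ − 1`, families replaced by their `e'`-sections).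
Iterating, the drop at `(D₁, D₂)` dominates the drop at the fibre in which `e` is the only active coordinate, and that drop is the value of a
one-coordinate fibre form, which is nonnegative (`f3sum_indicator_nonneg_card_one`).  The second-order statements were verified exhaustively for
`|D₁ ∪ D₂| ≤ 5` and sampled for `6, 7` (memo §7); every third-order analogue fails, so they are the natural next target.
Main results: `f3sum_drop_nonneg_of_tower` (second order ⟹ `M_hi`), `sahiE3_threshold_nonneg_of_tower` (⟹ Kahn C5 for every threshold slot).
-/

namespace Summit.CriticalPhenomena.PercolationContinuityZ3.Theorems

namespace SahiOneStep

open Finset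

section Generic

variable {κ : Type*} [DecidableEq κ]

/-- The quadruples of a fibre with a single active coordinate of type 1. -/
theorem f3quads_singleton_empty (e : κ) :
    f3quads ({e} : Finset κ) ∅ = {((∅, ∅), (∅, ∅)), (({e}, ∅), (∅, ∅)), ((∅, {e}), (∅, ∅))} := by
  ext q
  rw [mem_f3quads]
  simp only [Finset.mem_insert, Finset.mem_singleton, Finset.subset_empty]
  constructor
  · rintro ⟨⟨h1, h2⟩, ⟨h3, h4⟩, hd, -⟩
    rcases q with ⟨⟨a, b⟩, ⟨c, d⟩⟩
    simp only at h1 h2 h3 h4 hd ⊢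
    subst h3; subst h4
    rcases Finset.subset_singleton_iff.1 h1 with rfl | rfl <;> rcases Finset.subset_singleton_iff.1 h2 with rfl | rfl <;> simp_all
  · rintro (rfl | rfl | rfl) <;> simp

/-- The quadruples of a fibre with a single active coordinate of type 2. -/
theorem f3quads_empty_singleton (e : κ) :
    f3quads (∅ : Finset κ) {e} = {((∅, ∅), (∅, ∅)), ((∅, ∅), ({e}, ∅)), ((∅, ∅), (∅, {e}))} := by
  ext q
  rw [mem_f3quads]
  simp only [Finset.mem_insert, Finset.mem_singleton, Finset.subset_empty]
  constructor
  · rintro ⟨⟨h1, h2⟩, ⟨h3, h4⟩, -, hd⟩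
    rcases q with ⟨⟨a, b⟩, ⟨c, d⟩⟩
    simp only at h1 h2 h3 h4 hd ⊢
    subst h1; subst h2
    rcases Finset.subset_singleton_iff.1 h3 with rfl | rfl <;> rcases Finset.subset_singleton_iff.1 h4 with rfl | rfl <;> simp_all
  · rintro (rfl | rfl | rfl) <;> simp

/-- **A fibre form with a single active coordinate is nonnegative** on monotone `u, v` (monotone on the pair `∅ ⊆ {e}` suffices). [this work] -/
theorem f3sum_indicator_nonneg_card_one (D₁ D₂ : Finset κ) (hdisj : Disjoint D₁ D₂) (hcard : (D₁ ∪ D₂).card = 1) (θ : ℕ)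
    (u v : Finset κ → ℝ) (hu : ∀ e ∈ D₁ ∪ D₂, u ∅ ≤ u {e}) (hv : ∀ e ∈ D₁ ∪ D₂, v ∅ ≤ v {e}) :
    0 ≤ f3sum ℝ D₁ D₂ θ u v := by
  obtain ⟨e, he⟩ := Finset.card_eq_one.1 hcard
  have heD : e ∈ D₁ ∪ D₂ := by rw [he]; exact Finset.mem_singleton_self e
  have hue := hu e heD
  have hve := hv e heD
  -- either D₁ = {e}, D₂ = ∅ or D₁ = ∅, D₂ = {e}
  have hcases : (D₁ = {e} ∧ D₂ = ∅) ∨ (D₁ = ∅ ∧ D₂ = {e}) := by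
    rcases Finset.mem_union.1 heD with h1 | h2
    · left
      have hD2 : D₂ = ∅ := by
        rw [Finset.eq_empty_iff_forall_notMem]
        intro x hx
        have hx' : x ∈ D₁ ∪ D₂ := Finset.mem_union_right _ hx
        rw [he, Finset.mem_singleton] at hx'
        subst hx'
        exact Finset.disjoint_left.1 hdisj h1 hx
      refine ⟨?_, hD2⟩
      rw [hD2, Finset.union_empty] at he
      exact he
    · right
      have hD1 : D₁ = ∅ := by
        rw [Finset.eq_empty_iff_forall_notMem]
        intro x hx
        have hx' : x ∈ D₁ ∪ D₂ := Finset.mem_union_left _ hx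
        rw [he, Finset.mem_singleton] at hx'
        subst hx'
        exact Finset.disjoint_left.1 hdisj hx h2
      refine ⟨hD1, ?_⟩
      rw [hD1, Finset.empty_union] at he
      exact he
  rcases hcases with ⟨rfl, rfl⟩ | ⟨rfl, rfl⟩
  · unfold f3sum
    rw [f3quads_singleton_empty]
    rw [Finset.sum_insert (by simp), Finset.sum_insert (by simp), Finset.sum_singleton]
    simp only [f3term, f3S0, f3S1, f3S2, thrR, Finset.empty_union, Finset.union_empty, Finset.card_empty,
      Finset.card_singleton, Finset.sdiff_empty, Finset.union_idempotent, Finset.sdiff_self]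
    simp only [Finset.union_empty] at *
    by_cases h0 : θ ≤ 0 <;> by_cases h1 : θ ≤ 1 <;> simp only [h0, h1, if_true, if_false] <;> nlinarith [hue, hve]
  · unfold f3sum
    rw [f3quads_empty_singleton]
    rw [Finset.sum_insert (by simp), Finset.sum_insert (by simp), Finset.sum_singleton]
    simp only [f3term, f3S0, f3S1, f3S2, thrR, Finset.sdiff_empty, Finset.union_empty, Finset.empty_union, Finset.card_singleton,
      Finset.sdiff_self, Finset.card_empty]
    by_cases h0 : θ ≤ 0 <;> by_cases h1 : θ ≤ 1 <;> simp only [h0, h1, if_true, if_false] <;> nlinarith [hue, hve]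

/-- **`M_hi` from the second-order statements.**  Write `drop e D₁ D₂ θ u v := f3sum D₁ D₂ θ u v − f3sum (D₁.erase e) (D₂.erase e) (θ−1) (u ∘ insert e) (v ∘ insert e)`.
If for all disjoint `D₁, D₂`, all active `e ≠ e'` and all pairs of upper families the drop at `e` does not increase when `e'` is deleted (`e' ∈ D₁`)
or raised (`e' ∈ D₂`, threshold `θ − 1`, `e'`-sections), then the drop is nonnegative — i.e. the one-token monotonicity hypothesis of
`f3sum_indicator_nonneg_of_erase_mono` holds. [this work] -/
theorem f3sum_drop_nonneg_of_tower
    (hT1 : ∀ D₁ D₂ : Finset κ, Disjoint D₁ D₂ → ∀ e ∈ D₁ ∪ D₂, ∀ e' ∈ D₁, e' ≠ e → ∀ θ : ℕ, ∀ U V : Finset (Finset κ),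
      U ⊆ (D₁ ∪ D₂).powerset → (∀ S ∈ U, ∀ T ∈ (D₁ ∪ D₂).powerset, S ⊆ T → T ∈ U) →
      V ⊆ (D₁ ∪ D₂).powerset → (∀ S ∈ V, ∀ T ∈ (D₁ ∪ D₂).powerset, S ⊆ T → T ∈ V) →
      f3sum ℝ (D₁.erase e') D₂ θ (fun S => if S ∈ U then 1 else 0) (fun S => if S ∈ V then 1 else 0)
        - f3sum ℝ ((D₁.erase e').erase e) (D₂.erase e) (θ - 1) (fun S => if insert e S ∈ U then 1 else 0) (fun S => if insert e S ∈ V then 1 else 0)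
      ≤ f3sum ℝ D₁ D₂ θ (fun S => if S ∈ U then 1 else 0) (fun S => if S ∈ V then 1 else 0)
        - f3sum ℝ (D₁.erase e) (D₂.erase e) (θ - 1) (fun S => if insert e S ∈ U then 1 else 0) (fun S => if insert e S ∈ V then 1 else 0))
    (hT2 : ∀ D₁ D₂ : Finset κ, Disjoint D₁ D₂ → ∀ e ∈ D₁ ∪ D₂, ∀ e' ∈ D₂, e' ≠ e → ∀ θ : ℕ, ∀ U V : Finset (Finset κ),
      U ⊆ (D₁ ∪ D₂).powerset → (∀ S ∈ U, ∀ T ∈ (D₁ ∪ D₂).powerset, S ⊆ T → T ∈ U) →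
      V ⊆ (D₁ ∪ D₂).powerset → (∀ S ∈ V, ∀ T ∈ (D₁ ∪ D₂).powerset, S ⊆ T → T ∈ V) →
      f3sum ℝ D₁ (D₂.erase e') (θ - 1) (fun S => if insert e' S ∈ U then 1 else 0) (fun S => if insert e' S ∈ V then 1 else 0)
        - f3sum ℝ (D₁.erase e) ((D₂.erase e').erase e) (θ - 1 - 1) (fun S => if insert e (insert e' S) ∈ U then 1 else 0)
            (fun S => if insert e (insert e' S) ∈ V then 1 else 0)
      ≤ f3sum ℝ D₁ D₂ θ (fun S => if S ∈ U then 1 else 0) (fun S => if S ∈ V then 1 else 0)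
        - f3sum ℝ (D₁.erase e) (D₂.erase e) (θ - 1) (fun S => if insert e S ∈ U then 1 else 0) (fun S => if insert e S ∈ V then 1 else 0))
    (D₁ D₂ : Finset κ) (hdisj : Disjoint D₁ D₂) (e : κ) (he : e ∈ D₁ ∪ D₂) (θ : ℕ) (U V : Finset (Finset κ))
    (hU : U ⊆ (D₁ ∪ D₂).powerset) (hUup : ∀ S ∈ U, ∀ T ∈ (D₁ ∪ D₂).powerset, S ⊆ T → T ∈ U)
    (hV : V ⊆ (D₁ ∪ D₂).powerset) (hVup : ∀ S ∈ V, ∀ T ∈ (D₁ ∪ D₂).powerset, S ⊆ T → T ∈ V) :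
    f3sum ℝ (D₁.erase e) (D₂.erase e) (θ - 1) (fun S => if insert e S ∈ U then 1 else 0) (fun S => if insert e S ∈ V then 1 else 0)
      ≤ f3sum ℝ D₁ D₂ θ (fun S => if S ∈ U then 1 else 0) (fun S => if S ∈ V then 1 else 0) := by
  -- induction on the number of active coordinates, for all data
  suffices h : ∀ n : ℕ, ∀ D₁ D₂ : Finset κ, (D₁ ∪ D₂).card = n → Disjoint D₁ D₂ → ∀ e ∈ D₁ ∪ D₂, ∀ θ : ℕ, ∀ U V : Finset (Finset κ),
      U ⊆ (D₁ ∪ D₂).powerset → (∀ S ∈ U, ∀ T ∈ (D₁ ∪ D₂).powerset, S ⊆ T → T ∈ U) →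
      V ⊆ (D₁ ∪ D₂).powerset → (∀ S ∈ V, ∀ T ∈ (D₁ ∪ D₂).powerset, S ⊆ T → T ∈ V) →
      f3sum ℝ (D₁.erase e) (D₂.erase e) (θ - 1) (fun S => if insert e S ∈ U then 1 else 0) (fun S => if insert e S ∈ V then 1 else 0)
        ≤ f3sum ℝ D₁ D₂ θ (fun S => if S ∈ U then 1 else 0) (fun S => if S ∈ V then 1 else 0) from
    h _ D₁ D₂ rfl hdisj e he θ U V hU hUup hV hVup
  intro n
  induction n with
  | zero =>
    intro D₁ D₂ hcard _ e he
    rw [Finset.card_eq_zero] at hcard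
    rw [hcard] at he
    exact absurd he (Finset.notMem_empty e)
  | succ n ih =>
    intro D₁ D₂ hcard hdisj e he θ U V hU hUup hV hVup
    by_cases hn : n = 0
    · -- `e` is the only active coordinate: the child is the empty fibre form, the parent a one-coordinate fibre form
      subst hn
      have hDe : (D₁.erase e ∪ D₂.erase e) = ∅ := by
        rw [← Finset.erase_union_distrib, ← Finset.card_eq_zero, Finset.card_erase_of_mem he, hcard]
      rw [Finset.union_eq_empty] at hDe
      rw [hDe.1, hDe.2, f3sum_empty_empty]
      refine f3sum_indicator_nonneg_card_one D₁ D₂ hdisj hcard θ _ _ (fun f hf => ?_) (fun f hf => ?_)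
      · by_cases h0 : (∅ : Finset κ) ∈ U
        · have h1 : ({f} : Finset κ) ∈ U :=
            hUup ∅ h0 {f} (Finset.mem_powerset.2 (Finset.singleton_subset_iff.2 hf)) (Finset.empty_subset _)
          simp [h0, h1]
        · by_cases h1 : ({f} : Finset κ) ∈ U <;> simp [h0, h1]
      · by_cases h0 : (∅ : Finset κ) ∈ V
        · have h1 : ({f} : Finset κ) ∈ V :=
            hVup ∅ h0 {f} (Finset.mem_powerset.2 (Finset.singleton_subset_iff.2 hf)) (Finset.empty_subset _)
          simp [h0, h1]
        · by_cases h1 : ({f} : Finset κ) ∈ V <;> simp [h0, h1]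
    · -- pick a second active coordinate `e' ≠ e` and make it inactive by one flip
      have hcard2 : 1 < (D₁ ∪ D₂).card := by rw [hcard]; omega
      obtain ⟨e', he', hne⟩ := Finset.exists_mem_ne hcard2 e
      set D := D₁ ∪ D₂ with hD
      have heD' : e ∈ D.erase e' := Finset.mem_erase.2 ⟨hne.symm, he⟩
      rcases Finset.mem_union.1 he' with he'1 | he'2
      · -- `e' ∈ D₁`: delete `e'`
        have he'2 : e' ∉ D₂ := Finset.disjoint_left.1 hdisj he'1
        have hDe : D₁.erase e' ∪ D₂ = D.erase e' := by
          rw [hD, Finset.erase_union_distrib, Finset.erase_eq_of_notMem he'2]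
        set U' := (D.erase e').powerset.filter (fun S => S ∈ U) with hU'
        set V' := (D.erase e').powerset.filter (fun S => S ∈ V) with hV'
        have hkey := hT1 D₁ D₂ hdisj e he e' he'1 hne θ U V hU hUup hV hVup
        -- the neighbour's drop, rewritten on the families `U', V'`, is nonnegative by induction
        have hpar : f3sum ℝ (D₁.erase e') D₂ θ (fun S => if S ∈ U then (1:ℝ) else 0) (fun S => if S ∈ V then (1:ℝ) else 0)
            = f3sum ℝ (D₁.erase e') D₂ θ (fun S => if S ∈ U' then (1:ℝ) else 0) (fun S => if S ∈ V' then (1:ℝ) else 0) := by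
          rw [f3sum_congr_left (D₁.erase e') D₂ θ _ (u' := fun S => if S ∈ U' then (1:ℝ) else 0)
                (fun S hS => by simp only [hU', Finset.mem_filter, ← hDe, hS, true_and]),
              f3sum_congr_right (D₁.erase e') D₂ θ _ (v' := fun S => if S ∈ V' then (1:ℝ) else 0)
                (fun S hS => by simp only [hV', Finset.mem_filter, ← hDe, hS, true_and])]
        have hsub : ∀ S ∈ ((D₁.erase e').erase e ∪ D₂.erase e).powerset, insert e S ∈ (D.erase e').powerset := by
          intro S hS
          rw [Finset.mem_powerset] at hS ⊢
          rw [← Finset.erase_union_distrib, hDe] at hS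
          exact Finset.insert_subset heD' (hS.trans (Finset.erase_subset _ _))
        have hchi : f3sum ℝ ((D₁.erase e').erase e) (D₂.erase e) (θ - 1) (fun S => if insert e S ∈ U then (1:ℝ) else 0)
              (fun S => if insert e S ∈ V then (1:ℝ) else 0)
            = f3sum ℝ ((D₁.erase e').erase e) (D₂.erase e) (θ - 1) (fun S => if insert e S ∈ U' then (1:ℝ) else 0)
              (fun S => if insert e S ∈ V' then (1:ℝ) else 0) := by
          rw [f3sum_congr_left _ _ _ _ (u' := fun S => if insert e S ∈ U' then (1:ℝ) else 0)
                (fun S hS => by simp only [hU', Finset.mem_filter, hsub S hS, true_and]),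
              f3sum_congr_right _ _ _ _ (v' := fun S => if insert e S ∈ V' then (1:ℝ) else 0)
                (fun S hS => by simp only [hV', Finset.mem_filter, hsub S hS, true_and])]
        have hcard' : (D₁.erase e' ∪ D₂).card = n := by
          rw [hDe, Finset.card_erase_of_mem he', hcard]; rfl
        have hdisj' : Disjoint (D₁.erase e') D₂ := Finset.disjoint_of_subset_left (Finset.erase_subset e' D₁) hdisj
        have heIn : e ∈ D₁.erase e' ∪ D₂ := by rw [hDe]; exact heD'
        have hih := ih (D₁.erase e') D₂ hcard' hdisj' e heIn θ U' V'
          (by rw [hDe]; exact Finset.filter_subset _ _)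
          (by rw [hDe]; intro S hS T hT hST; rw [hU', Finset.mem_filter] at hS ⊢
              exact ⟨hT, hUup S hS.2 T (Finset.mem_powerset.2 ((Finset.mem_powerset.1 hT).trans (Finset.erase_subset _ _))) hST⟩)
          (by rw [hDe]; exact Finset.filter_subset _ _)
          (by rw [hDe]; intro S hS T hT hST; rw [hV', Finset.mem_filter] at hS ⊢
              exact ⟨hT, hVup S hS.2 T (Finset.mem_powerset.2 ((Finset.mem_powerset.1 hT).trans (Finset.erase_subset _ _))) hST⟩)
        rw [← hpar, ← hchi] at hih
        linarith
      · -- `e' ∈ D₂`: raise `e'` (threshold `θ - 1`, `e'`-sections)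
        have he'1 : e' ∉ D₁ := fun h => Finset.disjoint_left.1 hdisj h he'2
        have hDe : D₁ ∪ D₂.erase e' = D.erase e' := by
          rw [hD, Finset.erase_union_distrib, Finset.erase_eq_of_notMem he'1]
        set U' := (D.erase e').powerset.filter (fun S => insert e' S ∈ U) with hU'
        set V' := (D.erase e').powerset.filter (fun S => insert e' S ∈ V) with hV'
        have hkey := hT2 D₁ D₂ hdisj e he e' he'2 hne θ U V hU hUup hV hVup
        have hpar : f3sum ℝ D₁ (D₂.erase e') (θ - 1) (fun S => if insert e' S ∈ U then (1:ℝ) else 0) (fun S => if insert e' S ∈ V then (1:ℝ) else 0)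
            = f3sum ℝ D₁ (D₂.erase e') (θ - 1) (fun S => if S ∈ U' then (1:ℝ) else 0) (fun S => if S ∈ V' then (1:ℝ) else 0) := by
          rw [f3sum_congr_left D₁ (D₂.erase e') (θ - 1) _ (u' := fun S => if S ∈ U' then (1:ℝ) else 0)
                (fun S hS => by simp only [hU', Finset.mem_filter, ← hDe, hS, true_and]),
              f3sum_congr_right D₁ (D₂.erase e') (θ - 1) _ (v' := fun S => if S ∈ V' then (1:ℝ) else 0)
                (fun S hS => by simp only [hV', Finset.mem_filter, ← hDe, hS, true_and])]
        have hsub : ∀ S ∈ (D₁.erase e ∪ (D₂.erase e').erase e).powerset, insert e S ∈ (D.erase e').powerset := by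
          intro S hS
          rw [Finset.mem_powerset] at hS ⊢
          rw [← Finset.erase_union_distrib, hDe] at hS
          exact Finset.insert_subset heD' (hS.trans (Finset.erase_subset _ _))
        have hchi : f3sum ℝ (D₁.erase e) ((D₂.erase e').erase e) (θ - 1 - 1) (fun S => if insert e (insert e' S) ∈ U then (1:ℝ) else 0)
              (fun S => if insert e (insert e' S) ∈ V then (1:ℝ) else 0)
            = f3sum ℝ (D₁.erase e) ((D₂.erase e').erase e) (θ - 1 - 1) (fun S => if insert e S ∈ U' then (1:ℝ) else 0)
              (fun S => if insert e S ∈ V' then (1:ℝ) else 0) := by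
          rw [f3sum_congr_left _ _ _ _ (u' := fun S => if insert e S ∈ U' then (1:ℝ) else 0)
                (fun S hS => by simp only [hU', Finset.mem_filter, hsub S hS, true_and, Finset.insert_comm e e']),
              f3sum_congr_right _ _ _ _ (v' := fun S => if insert e S ∈ V' then (1:ℝ) else 0)
                (fun S hS => by simp only [hV', Finset.mem_filter, hsub S hS, true_and, Finset.insert_comm e e'])]
        have hcard' : (D₁ ∪ D₂.erase e').card = n := by
          rw [hDe, Finset.card_erase_of_mem he', hcard]; rfl
        have hdisj' : Disjoint D₁ (D₂.erase e') := Finset.disjoint_of_subset_right (Finset.erase_subset e' D₂) hdisj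
        have heIn : e ∈ D₁ ∪ D₂.erase e' := by rw [hDe]; exact heD'
        have he'D : e' ∈ D := he'
        have hih := ih D₁ (D₂.erase e') hcard' hdisj' e heIn (θ - 1) U' V'
          (by rw [hDe]; exact Finset.filter_subset _ _)
          (by rw [hDe]; exact section_upper he'D hUup)
          (by rw [hDe]; exact Finset.filter_subset _ _)
          (by rw [hDe]; exact section_upper he'D hVup)
        rw [← hpar, ← hchi] at hih
        linarith

end Generic

/-! ## The measure-level consequence -/

open MeasureTheory
open Literature.Probability.LatticeModels (prodBernoulli sahiE3)
open scoped Classical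

variable {ι : Type*} [Fintype ι] [DecidableEq ι]

/-- **KAHN C5 / SAHI C₃ FOR EVERY THRESHOLD FIRST SLOT FROM THE TWO SECOND-ORDER MONOTONICITY STATEMENTS** (memo §7: T11/T21 = `hT1`,
T12/T22 = `hT2`): for every finite `ι`, every product measure, every `F`, `t` and all increasing `A, B`, `E₃(Th_t(F), A, B) ≥ 0`. [this work] -/
theorem sahiE3_threshold_nonneg_of_tower
    (hT1 : ∀ D₁ D₂ : Finset ι, Disjoint D₁ D₂ → ∀ e ∈ D₁ ∪ D₂, ∀ e' ∈ D₁, e' ≠ e → ∀ θ : ℕ, ∀ U V : Finset (Finset ι),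
      U ⊆ (D₁ ∪ D₂).powerset → (∀ S ∈ U, ∀ T ∈ (D₁ ∪ D₂).powerset, S ⊆ T → T ∈ U) →
      V ⊆ (D₁ ∪ D₂).powerset → (∀ S ∈ V, ∀ T ∈ (D₁ ∪ D₂).powerset, S ⊆ T → T ∈ V) →
      f3sum ℝ (D₁.erase e') D₂ θ (fun S => if S ∈ U then 1 else 0) (fun S => if S ∈ V then 1 else 0)
        - f3sum ℝ ((D₁.erase e').erase e) (D₂.erase e) (θ - 1) (fun S => if insert e S ∈ U then 1 else 0) (fun S => if insert e S ∈ V then 1 else 0)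
      ≤ f3sum ℝ D₁ D₂ θ (fun S => if S ∈ U then 1 else 0) (fun S => if S ∈ V then 1 else 0)
        - f3sum ℝ (D₁.erase e) (D₂.erase e) (θ - 1) (fun S => if insert e S ∈ U then 1 else 0) (fun S => if insert e S ∈ V then 1 else 0))
    (hT2 : ∀ D₁ D₂ : Finset ι, Disjoint D₁ D₂ → ∀ e ∈ D₁ ∪ D₂, ∀ e' ∈ D₂, e' ≠ e → ∀ θ : ℕ, ∀ U V : Finset (Finset ι),
      U ⊆ (D₁ ∪ D₂).powerset → (∀ S ∈ U, ∀ T ∈ (D₁ ∪ D₂).powerset, S ⊆ T → T ∈ U) →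
      V ⊆ (D₁ ∪ D₂).powerset → (∀ S ∈ V, ∀ T ∈ (D₁ ∪ D₂).powerset, S ⊆ T → T ∈ V) →
      f3sum ℝ D₁ (D₂.erase e') (θ - 1) (fun S => if insert e' S ∈ U then 1 else 0) (fun S => if insert e' S ∈ V then 1 else 0)
        - f3sum ℝ (D₁.erase e) ((D₂.erase e').erase e) (θ - 1 - 1) (fun S => if insert e (insert e' S) ∈ U then 1 else 0)
            (fun S => if insert e (insert e' S) ∈ V then 1 else 0)
      ≤ f3sum ℝ D₁ D₂ θ (fun S => if S ∈ U then 1 else 0) (fun S => if S ∈ V then 1 else 0)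
        - f3sum ℝ (D₁.erase e) (D₂.erase e) (θ - 1) (fun S => if insert e S ∈ U then 1 else 0) (fun S => if insert e S ∈ V then 1 else 0))
    (p : ι → unitInterval) (F : Finset ι) (t : ℕ) {A B : Set (Set ι)} (hA : IsUpperSet A) (hB : IsUpperSet B) :
    0 ≤ sahiE3 (prodBernoulli p) {ω : Set ι | t ≤ (F.filter (· ∈ ω)).card} A B :=
  sahiE3_threshold_nonneg_of_erase_mono
    (fun D₁ D₂ hd e he θ U V hU hUup hV hVup => f3sum_drop_nonneg_of_tower hT1 hT2 D₁ D₂ hd e he θ U V hU hUup hV hVup) p F t hA hB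

end SahiOneStep

end Summit.CriticalPhenomena.PercolationContinuityZ3.Theorems
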